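import Summits.CriticalPhenomena.PercolationContinuityZ3.Theses.PercRayRenewal
import Summits.CriticalPhenomena.PercolationContinuityZ3.Theorems.PercNearOneGluingNoHeavyLowerTailCSHTheoremOne
import HarnessLib

/-!
# `PercRayRenewal.JumpTruncatedOneArmDecay` (stmt-CriticalPhenomena-4627) — SETTLED after continuity

Item `stmt-CriticalPhenomena-4627` of route `CriticalPhenomena/PercRayRenewal` (crux r4, "G1′ — in
the jump world finite clusters have a power-law radius tail").

The item is a statement about the counterfactual 'jump world': its hypothesis is
`0 < θ(p_c(ℤ³))`, which contradicts the tree theorem `θ(p_c(ℤ³)) = 0`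
(`CSH.percolationContinuityZ3_holds`, p205010); so the implication holds vacuously (the route's own
docstring: "Vacuous iff θ(p_c)=0"). No percolation estimate is claimed here beyond p205010.

builds on p205010 (kernel theorem, internal audit signed; external expert review pending) — USED
(`CSH.percolationContinuityZ3_holds`). RSW3 lane, lead gen 33 (prover-prim-rsw3-lead-g33-0).
References: G. Kozma, N. Nitzan (2024), Thm. 6 / Conj. 3 [KozmaNitzan2024]; G. Grimmett,
*Percolation* (1999), §8 [GrimmettPercolation1999].
-/

noncomputable section

namespace Summit.CriticalPhenomena.PercolationContinuityZ3.Theorems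

namespace PercRayRenewalJumpTruncatedOneArmDecay

open MeasureTheory Literature.Probability.Percolation Literature.Probability.LatticeModels

/-- **`PercRayRenewal.JumpTruncatedOneArmDecay` (stmt-CriticalPhenomena-4627), settled.** Its
hypothesis `0 < θ(p_c(ℤ³))` contradicts the tree theorem `θ(p_c(ℤ³)) = 0`
(`CSH.percolationContinuityZ3_holds`, p205010): vacuous.
[cite: KozmaNitzan2024, Thm. 6 with Conj. 3 (p. 15)] -/
theorem jumpTruncatedOneArmDecay_proof :
    Summit.CriticalPhenomena.PercolationContinuityZ3.Theses.PercRayRenewal.JumpTruncatedOneArmDecay := by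
  unfold Summit.CriticalPhenomena.PercolationContinuityZ3.Theses.PercRayRenewal.JumpTruncatedOneArmDecay
  intro hθ
  have h0 : theta (zdGraph 3) (0 : Site 3) (criticalProbI 3) = 0 := CSH.percolationContinuityZ3_holds
  exact absurd h0 (ne_of_gt hθ)

end PercRayRenewalJumpTruncatedOneArmDecay

end Summit.CriticalPhenomena.PercolationContinuityZ3.Theorems

end
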